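import Mathlib

/-!
# Integration tools for infinite product measures

Generic identities for the product `Measure.infinitePi μ` of probability measures, used by
expansions of lattice models whose a-priori measure is a product over sites or bonds (e.g. the
product Haar measure `∏_bonds dU_ℓ` of lattice gauge theory, Osterwalder–Seiler 1978 §2.1):

* **Resampling one coordinate** (`map_update_infinitePi_prod`): replacing the `i₀`-th
  coordinate of a `⨂ μ`-sample by an independent `μ i₀`-sample gives a `⨂ μ`-sample; hence
  one coordinate can be integrated out first,
  `∫ F d(⨂ μ) = ∫ (∫ F (update x i₀ y) dμ_{i₀}(y)) d(⨂ μ)(x)` for integrable `F`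
  (`integral_infinitePi_eq_integral_update`), and a function with zero mean in one coordinate
  has zero integral (`integral_infinitePi_eq_zero_of_update`; the mechanism by which polymers
  with a singly covered bond drop out of the strong-coupling expansion).
* **Factorisation over disjoint supports** (`integral_mul_eq_of_dependsOn_disjoint`): bounded
  measurable functions depending on disjoint finite sets of coordinates are independent
  (`ProbabilityTheory.iIndepFun_infinitePi`), so the integral of their product is the product
  of their integrals; `exists_measurable_comp_restrict` is the measurable factorisation of a
  function depending on finitely many coordinates.
* **Invariance** for identical factors: under permutations of the coordinates
  (`map_reindex_infinitePi`, `integral_comp_reindex_infinitePi`) and under coordinatewise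
  measure-preserving maps (`map_pi_infinitePi`).

All statements are folklore measure theory, proved in full from Mathlib's `Measure.infinitePi`
API.

## Mathlib anchors

`MeasureTheory.Measure.infinitePi`, `Measure.eq_infinitePi`, `Measure.infinitePi_pi`,
`Measure.infinitePi_map_pi`, `Measure.map_infinitePi_infinitePi_of_inj`,
`ProbabilityTheory.iIndepFun_infinitePi`, `iIndepFun.indepFun_finset`,
`IndepFun.integral_fun_mul_eq_mul_integral`, `MeasureTheory.integral_prod`,
`integrable_map_measure`, `measurable_update'`.

## References

* K. Osterwalder, E. Seiler, *Gauge field theories on a lattice*, Ann. Phys. **110** (1978)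
  440–471, §2.1 (the product Haar measure) and §3. [OsterwalderSeilerAnnPhys1978]
-/

open MeasureTheory Measure ProbabilityTheory Finset

namespace Literature.Probability.LatticeModels

section Resample

variable {ι : Type*} {X : ι → Type*} [∀ i, MeasurableSpace (X i)]
  (μ : (i : ι) → Measure (X i)) [∀ i, IsProbabilityMeasure (μ i)]

/-- **Resampling one coordinate**: replacing the `i₀`-th coordinate of an `infinitePi μ`-sample
by an independent `μ i₀`-sample gives again an `infinitePi μ`-sample (checked on boxes,
`Measure.eq_infinitePi`). [folklore] -/
theorem map_update_infinitePi_prod [DecidableEq ι] (i₀ : ι) :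
    ((infinitePi μ).prod (μ i₀)).map (fun p : (Π i, X i) × X i₀ => Function.update p.1 i₀ p.2) =
      infinitePi μ := by
  have hmeas : Measurable fun p : (Π i, X i) × X i₀ => Function.update p.1 i₀ p.2 :=
    measurable_update'
  refine eq_infinitePi μ fun s t ht => ?_
  rw [map_apply hmeas (MeasurableSet.pi s.countable_toSet fun i _ => ht i)]
  -- the preimage of the box is a product of a box and `t i₀` (or `univ`)
  by_cases hi : i₀ ∈ s
  · have hpre : (fun p : (Π i, X i) × X i₀ => Function.update p.1 i₀ p.2) ⁻¹' Set.pi s t =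
        (Set.pi (↑(s.erase i₀)) t) ×ˢ t i₀ := by
      ext ⟨x, y⟩
      simp only [Set.mem_preimage, Set.mem_pi, Finset.mem_coe, Set.mem_prod, Finset.mem_erase]
      constructor
      · intro h
        refine ⟨fun i hi' => ?_, by simpa using h i₀ hi⟩
        have := h i hi'.2
        rwa [Function.update_of_ne hi'.1] at this
      · rintro ⟨h1, h2⟩ i his
        by_cases hii : i = i₀
        · subst hii; simpa using h2
        · rw [Function.update_of_ne hii]; exact h1 i ⟨hii, his⟩
    rw [hpre, prod_prod, infinitePi_pi _ (fun i _ => ht i), ← Finset.prod_erase_mul _ _ hi]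
  · have hpre : (fun p : (Π i, X i) × X i₀ => Function.update p.1 i₀ p.2) ⁻¹' Set.pi s t =
        (Set.pi (↑s) t) ×ˢ Set.univ := by
      ext ⟨x, y⟩
      simp only [Set.mem_preimage, Set.mem_pi, Finset.mem_coe, Set.mem_prod, Set.mem_univ, and_true]
      constructor
      · intro h i his
        have := h i his
        rwa [Function.update_of_ne (ne_of_mem_of_not_mem his hi)] at this
      · intro h i his
        rw [Function.update_of_ne (ne_of_mem_of_not_mem his hi)]; exact h i his
    rw [hpre, prod_prod, infinitePi_pi _ (fun i _ => ht i), measure_univ, mul_one]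

/-- **Integrating out one coordinate**: for an integrable `F`,
`∫ F d(⨂ μ) = ∫ (∫ F (update x i₀ y) dμ_{i₀}(y)) d(⨂ μ)(x)` (resampling and Fubini). [folklore] -/
theorem integral_infinitePi_eq_integral_update [DecidableEq ι] (i₀ : ι) {F : (Π i, X i) → ℝ}
    (hF : Integrable F (infinitePi μ)) :
    ∫ x, F x ∂infinitePi μ = ∫ x, ∫ y, F (Function.update x i₀ y) ∂μ i₀ ∂infinitePi μ := by
  have hmeas : Measurable fun p : (Π i, X i) × X i₀ => Function.update p.1 i₀ p.2 :=
    measurable_update'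
  have hmap := map_update_infinitePi_prod μ i₀
  have hFm : AEStronglyMeasurable F (((infinitePi μ).prod (μ i₀)).map
      fun p : (Π i, X i) × X i₀ => Function.update p.1 i₀ p.2) := by
    rw [hmap]; exact hF.aestronglyMeasurable
  have hint : Integrable (fun p : (Π i, X i) × X i₀ => F (Function.update p.1 i₀ p.2))
      ((infinitePi μ).prod (μ i₀)) :=
    (integrable_map_measure hFm hmeas.aemeasurable).1 (by rw [hmap]; exact hF)
  calc ∫ x, F x ∂infinitePi μ
      = ∫ x, F x ∂(((infinitePi μ).prod (μ i₀)).map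
          fun p : (Π i, X i) × X i₀ => Function.update p.1 i₀ p.2) := by rw [hmap]
    _ = ∫ p, F (Function.update p.1 i₀ p.2) ∂((infinitePi μ).prod (μ i₀)) :=
        integral_map hmeas.aemeasurable hFm
    _ = ∫ x, ∫ y, F (Function.update x i₀ y) ∂μ i₀ ∂infinitePi μ := integral_prod _ hint

/-- **Zero-mean coordinates kill the integral**: if `∫ F (update x i₀ y) dμ_{i₀}(y) = 0` for every
`x`, then `∫ F d(⨂ μ) = 0`. [folklore] -/
theorem integral_infinitePi_eq_zero_of_update [DecidableEq ι] (i₀ : ι) {F : (Π i, X i) → ℝ}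
    (hF : Integrable F (infinitePi μ))
    (h0 : ∀ x, ∫ y, F (Function.update x i₀ y) ∂μ i₀ = 0) :
    ∫ x, F x ∂infinitePi μ = 0 := by
  rw [integral_infinitePi_eq_integral_update μ i₀ hF]
  simp [h0]

end Resample


section Factorise

variable {ι : Type*} {X : ι → Type*} [∀ i, MeasurableSpace (X i)]
  (μ : (i : ι) → Measure (X i)) [∀ i, IsProbabilityMeasure (μ i)]

/-- A function depending only on the coordinates in `S` factors through the restriction to `S`,
measurably (extend by a base point off `S`). [folklore] -/
theorem exists_measurable_comp_restrict [DecidableEq ι] (S : Finset ι) (x₀ : Π i, X i)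
    {F : (Π i, X i) → ℝ} (hF : Measurable F) (hdep : DependsOn F (S : Set ι)) :
    ∃ F' : (Π i : S, X i) → ℝ, Measurable F' ∧ F = F' ∘ fun x (i : S) => x i := by
  refine ⟨fun z => F (fun i => if h : i ∈ S then z ⟨i, h⟩ else x₀ i), ?_, ?_⟩
  · refine hF.comp (measurable_pi_lambda _ fun i => ?_)
    by_cases h : i ∈ S
    · simp only [h, dif_pos]; exact measurable_pi_apply _
    · simp only [h, dif_neg, not_false_eq_true]; exact measurable_const
  · ext x
    refine hdep fun i hi => ?_
    simp [Finset.mem_coe.1 hi]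

/-- **Factorisation over disjoint supports**: under the product measure, bounded measurable
functions depending on disjoint finite sets of coordinates are independent, so the integral of
the product is the product of the integrals. [folklore] -/
theorem integral_mul_eq_of_dependsOn_disjoint [DecidableEq ι] {S T : Finset ι}
    (hST : Disjoint S T) {F G : (Π i, X i) → ℝ} (hFm : Measurable F) (hGm : Measurable G)
    (hF : DependsOn F (S : Set ι)) (hG : DependsOn G (T : Set ι)) :
    ∫ x, F x * G x ∂infinitePi μ = (∫ x, F x ∂infinitePi μ) * ∫ x, G x ∂infinitePi μ := by
  classical
  rcases isEmpty_or_nonempty (Π i, X i) with hE | ⟨⟨x₀⟩⟩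
  · simp [integral_of_isEmpty]
  obtain ⟨F', hF'm, hFF'⟩ := exists_measurable_comp_restrict S x₀ hFm hF
  obtain ⟨G', hG'm, hGG'⟩ := exists_measurable_comp_restrict T x₀ hGm hG
  have hind : IndepFun (fun x (i : S) => x (i : ι)) (fun x (i : T) => x (i : ι)) (infinitePi μ) :=
    (iIndepFun_infinitePi (P := μ) (X := fun i (y : X i) => y) fun i =>
      measurable_id).indepFun_finset S T hST fun i => measurable_pi_apply i
  have hind' : IndepFun F G (infinitePi μ) := by
    rw [hFF', hGG']
    exact hind.comp hF'm hG'm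
  exact hind'.integral_fun_mul_eq_mul_integral hFm.aestronglyMeasurable hGm.aestronglyMeasurable

end Factorise

section Reindex

variable {ι : Type*} {Y : Type*} [MeasurableSpace Y] (ν : Measure Y) [IsProbabilityMeasure ν]

/-- **Permuting coordinates** preserves the product of identical factors. [folklore] -/
theorem map_reindex_infinitePi (σ : ι ≃ ι) :
    (infinitePi fun _ : ι => ν).map (fun (x : ι → Y) i => x (σ i)) = infinitePi fun _ : ι => ν :=
  map_infinitePi_infinitePi_of_inj (P := fun _ : ι => ν) σ.injective

/-- Integrals are invariant under permutations of the coordinates (identical factors).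
[folklore] -/
theorem integral_comp_reindex_infinitePi (σ : ι ≃ ι) {F : (ι → Y) → ℝ}
    (hF : AEStronglyMeasurable F (infinitePi fun _ : ι => ν)) :
    ∫ x, F (fun i => x (σ i)) ∂infinitePi (fun _ : ι => ν) =
      ∫ x, F x ∂infinitePi fun _ : ι => ν := by
  have hmeas : Measurable fun (x : ι → Y) i => x (σ i) :=
    measurable_pi_lambda _ fun i => measurable_pi_apply _
  rw [← integral_map hmeas.aemeasurable (by rwa [map_reindex_infinitePi]), map_reindex_infinitePi]

/-- **Coordinatewise measure-preserving maps** preserve the product measure (identical factors;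
`Measure.infinitePi_map_pi`). [folklore] -/
theorem map_pi_infinitePi {f : ι → Y → Y} (hf : ∀ i, Measurable (f i))
    (hpres : ∀ i, ν.map (f i) = ν) :
    (infinitePi fun _ : ι => ν).map (fun (x : ι → Y) i => f i (x i)) =
      infinitePi fun _ : ι => ν := by
  rw [infinitePi_map_pi (μ := fun _ : ι => ν) hf]
  simp_rw [hpres]

end Reindex

end Literature.Probability.LatticeModels
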